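import Summits.KontsevichZagierPeriods.KontsevichZagierPeriods.Theorems.LinRedNormalFormArrangementNormalFormStubRebaseSimplePosOneFibreWalls
import Summits.KontsevichZagierPeriods.KontsevichZagierPeriods.Theorems.LinRedNormalFormArrangementNormalFormStubRebaseSimplePosOneFibreSwapBand

/-!
# Stub `stub_rebaseSimplePosOne` (crux `ArrangementNormalForm`, line `janus-bands`, v6.2) —
part `Double`: the one-fibre rebase reduced to parallel bands and DOUBLE corners

Assembly of parts `Thick`, `Corner`, `ResidualSub`, `Walls`, `SwapForms`, `Swap`,
`OrderGood`, `SwapSheared`, `SwapBand` for the registered exponents `n₁ = 0`, `n₂ = 1` (base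
factor `g(x')/(y − ℓ₂(x'))`). A lettered band above its letter `0` with transverse bounds
`u < v` above its apex level `κ` (`A > 0`; the residual hypotheses `Hthick`, `Hfar` of
`rebaseSimplePos_oneFibre_of_residual`) is cut by the walls `κ = ±Φ`,
`Φ(x') = (v − u)(x', ℓ₂(x'))` (`RebasePos.good_of_walls`):
* where `|Φ| ≤ |κ|`, a cell without corner is thick and a corner is DOUBLE — the apex of the
  band lies on the letter AND on the pole hyperplane `y = ℓ₂(x')` (`RebasePos.good_thick_le`,
  `good_far_le`);
* where `|κ| < |Φ|`, the coordinate swap `y ↔ t` (`RebasePos.good_swapBand`, rules 2 and 1a)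
  produces bands with base pole `0` whose apex level is `Φ`-like and whose `Φ` is `κ`: again
  every corner met is double (for the swapped parameters).
Hence (`RebasePos.good_above_of_double`, `rebaseSimplePos_oneFibre_of_double`, and the
stub-format `rebaseSimplePos_oneFibre_of_double'`): `GS (b+1) 1 → closure (GG (b+1) 2 1)`
modulo `KZ.relations` as soon as PARALLEL bands (`Hpar`) and DOUBLE-CORNER bands (`Hdthick`,
`Hdfar`: corner `κ = u = v = 0` in the closure of the open base cell with `y = ℓ₂(x')` there)
are congruent to the subgroup generated by `GG (b+1) 2 1`. For `b = 0` (base `(x, y)`) the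
double corners are the non-generic coincidence of the zero of `κ(x)` with the zero of
`y*(x) − ℓ₂(x)`; member: `[{0 < x < y < 1, y − x < t < 2y − x}, 1/(y t)]` (`κ = −x`, `A = 1`,
`y* = 0 = ℓ₂`). Registered as `rebaseSimplePos_oneFibre_of_double`.

References: M. Kontsevich, D. Zagier, *Periods* (2001), §1.2, rules (1a), (2).
-/

noncomputable section

open Set MeasureTheory MvPolynomial
open Literature.NumberTheory.Transcendental Literature.ModelTheory.ExponentialFields

namespace Summit.KontsevichZagierPeriods.ArrangementNormalForm.JanusBands

namespace RebasePos

open SeparatePos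

section Double

variable {B m m' : ℕ}

/-- Algebra of the apex relation `u − κ = A (v − u)` (`κ` free of `y`): the bounds are
non-parallel, of the same sign in `y`, and `u(x', ℓ₂) = κ + A Φ`. -/
theorem apex_facts (u v κ : (Fin (B + 1) → ℚ) × ℚ) (A : ℚ) (ℓ₂ : (Fin B → ℚ) × ℚ)
    (hu : u.1 (Fin.last B) ≠ 0) (hκ : κ.1 (Fin.last B) = 0) (hA : u - κ = A • (v - u)) (hA0 : 0 < A) :
    (v - u).1 (Fin.last B) ≠ 0 ∧ u.1 (Fin.last B) ≠ v.1 (Fin.last B) ∧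
    (0 < u.1 (Fin.last B) ↔ 0 < v.1 (Fin.last B)) ∧
    restr B u + u.1 (Fin.last B) • ℓ₂ =
      restr B κ + A • ((restr B v - restr B u) + (v.1 (Fin.last B) - u.1 (Fin.last B)) • ℓ₂) := by
  have hA1 : ∀ j, u.1 j - κ.1 j = A * (v.1 j - u.1 j) := fun j => by
    have := congrArg (fun q : (Fin (B + 1) → ℚ) × ℚ => q.1 j) hA
    simpa using this
  have hA2 : u.2 - κ.2 = A * (v.2 - u.2) := by
    have := congrArg Prod.snd hA
    simpa using this
  have hy := hA1 (Fin.last B)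
  rw [hκ, sub_zero] at hy
  refine ⟨fun h0 => ?_, fun h => ?_, ?_, ?_⟩
  · rw [Prod.fst_sub, Pi.sub_apply] at h0
    rw [h0, mul_zero] at hy
    exact hu hy
  · rw [h, sub_self, mul_zero] at hy
    exact hu (h.trans hy)
  · constructor <;> intro h <;> nlinarith
  · refine Prod.ext (funext fun i => ?_) ?_
    · simp only [restr, Prod.fst_add, Prod.smul_fst, Pi.add_apply, Pi.smul_apply, Prod.fst_sub,
        Pi.sub_apply, smul_eq_mul]
      linear_combination hA1 (Fin.castSucc i) + ℓ₂.1 i * hy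
    · simp only [restr, Prod.snd_add, Prod.smul_snd, Prod.snd_sub, smul_eq_mul]
      linear_combination hA2 + ℓ₂.2 * hy

variable (L : Fin m → (Fin B → ℚ) × ℚ) (e : Fin m → ℕ) (ℓ₁ ℓ₂ : (Fin B → ℚ) × ℚ)

/-- **A band above its letter, from parallel bands and DOUBLE-corner bands** (exponents
`n₁ = 0`, `n₂ = 1`). See the module docstring. The hypotheses come in two copies: for the base
pole `ℓ₂` and for the base pole `0` (the swapped parameters). -/
theorem good_above_of_double (s : KZ.IntegralRep (B + 1 + 1)) (M : Fin m' → (Fin (B + 1) → ℚ) × ℚ)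
    (p : MvPolynomial (Fin B) ℚ) (u v : (Fin (B + 1) → ℚ) × ℚ)
    (hbd : Bornology.IsBounded s.domain)
    (hdom : s.domain = gDom B 1 m' M (fun _ => Sum.inr u) (fun _ => Sum.inr v))
    (hint : EqOn s.integrand (glit B 1 p L e ℓ₁ ℓ₂ 0 1 (fun _ => some 0)) s.domain)
    (hu : u.1 (Fin.last B) ≠ 0) (hv : v.1 (Fin.last B) ≠ 0)
    (hcell : ∀ z : Fin (B + 1 + 1) → ℝ, (∀ j, 0 < affF B 1 (M j) z) →
      0 < affF B 1 u z ∧ affF B 1 u z < affF B 1 v z)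
    (Hpar : ∀ (ℓ : (Fin B → ℚ) × ℚ), (ℓ = ℓ₂ ∨ ℓ = 0) →
      ∀ (m' : ℕ) (s : KZ.IntegralRep (B + 1 + 1)) (M : Fin m' → (Fin (B + 1) → ℚ) × ℚ)
      (p : MvPolynomial (Fin B) ℚ) (u v : (Fin (B + 1) → ℚ) × ℚ), Bornology.IsBounded s.domain →
      s.domain = gDom B 1 m' M (fun _ => Sum.inr u) (fun _ => Sum.inr v) →
      EqOn s.integrand (glit B 1 p L e ℓ₁ ℓ 0 1 (fun _ => some 0)) s.domain →
      u.1 (Fin.last B) ≠ 0 → u.1 (Fin.last B) = v.1 (Fin.last B) →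
      (∀ z : Fin (B + 1 + 1) → ℝ, (∀ j, 0 < affF B 1 (M j) z) → 0 < affF B 1 u z ∧ affF B 1 u z < affF B 1 v z) →
      ∃ c ∈ AddSubgroup.closure (GGset B 2 1), KZ.of s - c ∈ KZ.relations)
    (Hdthick : ∀ (ℓ : (Fin B → ℚ) × ℚ), (ℓ = ℓ₂ ∨ ℓ = 0) →
      ∀ (m' : ℕ) (s : KZ.IntegralRep (B + 1 + 1)) (M : Fin m' → (Fin (B + 1) → ℚ) × ℚ)
      (p : MvPolynomial (Fin B) ℚ) (u v κ : (Fin (B + 1) → ℚ) × ℚ) (A : ℚ), Bornology.IsBounded s.domain →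
      s.domain = gDom B 1 m' M (fun _ => Sum.inr u) (fun _ => Sum.inr v) →
      EqOn s.integrand (glit B 1 p L e ℓ₁ ℓ 0 1 (fun _ => some 0)) s.domain →
      κ.1 (Fin.last B) = 0 → u - κ = A • (v - u) → 0 < A →
      (∀ z : Fin (B + 1 + 1) → ℝ, (∀ j, 0 < affF B 1 (M j) z) →
        affF B 1 κ z < 0 ∧ 0 < affF B 1 u z ∧ affF B 1 u z < affF B 1 v z) →
      (∃ z ∈ closure {z : Fin (B + 1 + 1) → ℝ | ∀ j, 0 < affF B 1 (M j) z},
        affF B 1 κ z = 0 ∧ affF B 1 u z = 0 ∧ affF B 1 v z = 0 ∧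
        z (Fin.castAdd 1 (Fin.last B)) = affB B 1 ℓ z) →
      ∃ c ∈ AddSubgroup.closure (GGset B 2 1), KZ.of s - c ∈ KZ.relations)
    (Hdfar : ∀ (ℓ : (Fin B → ℚ) × ℚ), (ℓ = ℓ₂ ∨ ℓ = 0) →
      ∀ (m' : ℕ) (s : KZ.IntegralRep (B + 1 + 1)) (M : Fin m' → (Fin (B + 1) → ℚ) × ℚ)
      (p : MvPolynomial (Fin B) ℚ) (u v κ : (Fin (B + 1) → ℚ) × ℚ) (A : ℚ), Bornology.IsBounded s.domain →
      s.domain = gDom B 1 m' M (fun _ => Sum.inr u) (fun _ => Sum.inr v) →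
      EqOn s.integrand (glit B 1 p L e ℓ₁ ℓ 0 1 (fun _ => some 0)) s.domain →
      κ.1 (Fin.last B) = 0 → u - κ = A • (v - u) → 0 < A →
      (∀ z : Fin (B + 1 + 1) → ℝ, (∀ j, 0 < affF B 1 (M j) z) →
        0 < affF B 1 κ z ∧ affF B 1 u z < affF B 1 v z ∧ 2 * affF B 1 κ z ≤ affF B 1 v z) →
      (∃ z ∈ closure {z : Fin (B + 1 + 1) → ℝ | ∀ j, 0 < affF B 1 (M j) z},
        affF B 1 κ z = 0 ∧ affF B 1 u z = 0 ∧ affF B 1 v z = 0 ∧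
        z (Fin.castAdd 1 (Fin.last B)) = affB B 1 ℓ z) →
      ∃ c ∈ AddSubgroup.closure (GGset B 2 1), KZ.of s - c ∈ KZ.relations) :
    ∃ c ∈ AddSubgroup.closure (GGset B 2 1), KZ.of s - c ∈ KZ.relations := by
  -- the region invariant of a piece with `|κ| < |Φ|`
  have hregion : ∀ {m₁ : ℕ} (M₁ : Fin m₁ → (Fin (B + 1) → ℚ) × ℚ) (κ : (Fin (B + 1) → ℚ) × ℚ)
      (s₁ : KZ.IntegralRep (B + 1 + 1)), κ.1 (Fin.last B) = 0 →
      s₁.domain = gDom B 1 m₁ M₁ (fun _ => Sum.inr u) (fun _ => Sum.inr v) →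
      (∀ z : Fin (B + 1 + 1) → ℝ, (∀ j, 0 < affF B 1 (M₁ j) z) → |affF B 1 κ z| <
        |affF B 1 (((Fin.snoc (((restr B v - restr B u) + (v.1 (Fin.last B) - u.1 (Fin.last B)) • ℓ₂)).1 0 : Fin (B + 1) → ℚ), (((restr B v - restr B u) + (v.1 (Fin.last B) - u.1 (Fin.last B)) • ℓ₂)).2) : (Fin (B + 1) → ℚ) × ℚ) z|) →
      ∀ w ∈ s₁.domain, |affB B 1 (restr B κ) w| <
        |affB B 1 ((restr B v - restr B u) + (v.1 (Fin.last B) - u.1 (Fin.last B)) • ℓ₂) w| := by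
    intro m₁ M₁ κ s₁ hκ hdom₁ hstrict w hw
    rw [hdom₁, mem_gDom_one] at hw
    have h := hstrict w hw.1
    rwa [affF_liftB, affF_split, hκ, Rat.cast_zero, zero_mul, zero_add] at h
  refine good_above_of_corner₂ L e ℓ₁ ℓ₂ 0 1 s M p u v (Or.inl rfl) hbd hdom hint hu hv hcell
    (Hpar ℓ₂ (Or.inl rfl)) (fun m'' s' M' κ A hsub hbd' hdom' hint' hκ hA hA0 hcell' _ => ?_)
    (fun m'' s' M' κ A hsub hbd' hdom' hint' hκ hA hA0 hcell' _ => ?_)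
  · obtain ⟨hφ, hne, hsame, huℓ⟩ := apex_facts u v κ A ℓ₂ hu hκ hA hA0
    refine good_of_walls s' M' u v κ
      (((Fin.snoc (((restr B v - restr B u) + (v.1 (Fin.last B) - u.1 (Fin.last B)) • ℓ₂)).1 0 : Fin (B + 1) → ℚ), (((restr B v - restr B u) + (v.1 (Fin.last B) - u.1 (Fin.last B)) • ℓ₂)).2) : (Fin (B + 1) → ℚ) × ℚ) hdom'
      (fun m₁ s₁ M₁ hsub₁ hdom₁ hi₁ hrows hreg => ?_) (fun m₁ s₁ M₁ hsub₁ hdom₁ hi₁ hrows hstrict => ?_)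
    · exact good_thick_le L e ℓ₁ ℓ₂ 0 1 s₁ M₁ p u v κ A (Or.inl rfl) (hbd'.subset hsub₁) hdom₁
        (by rw [hi₁]; exact hint'.mono hsub₁) hκ hA hA0 hφ (fun z hz => hcell' z (hrows z hz)) hreg
        (Hdthick ℓ₂ (Or.inl rfl))
    · exact good_swapBand L e ℓ₁ ℓ₂ s₁ M₁ p u v (restr B κ) A (hbd'.subset hsub₁) hdom₁
        (by rw [hi₁]; exact hint'.mono hsub₁) hu hv hne hsame huℓ (hregion M₁ κ s₁ hκ hdom₁ hstrict)
        (Hpar 0 (Or.inr rfl)) (Hdthick 0 (Or.inr rfl)) (Hdfar 0 (Or.inr rfl))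
  · obtain ⟨hφ, hne, hsame, huℓ⟩ := apex_facts u v κ A ℓ₂ hu hκ hA hA0
    refine good_of_walls s' M' u v κ
      (((Fin.snoc (((restr B v - restr B u) + (v.1 (Fin.last B) - u.1 (Fin.last B)) • ℓ₂)).1 0 : Fin (B + 1) → ℚ), (((restr B v - restr B u) + (v.1 (Fin.last B) - u.1 (Fin.last B)) • ℓ₂)).2) : (Fin (B + 1) → ℚ) × ℚ) hdom'
      (fun m₁ s₁ M₁ hsub₁ hdom₁ hi₁ hrows hreg => ?_) (fun m₁ s₁ M₁ hsub₁ hdom₁ hi₁ hrows hstrict => ?_)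
    · exact good_far_le L e ℓ₁ ℓ₂ 0 1 s₁ M₁ p u v κ A (Or.inl rfl) (hbd'.subset hsub₁) hdom₁
        (by rw [hi₁]; exact hint'.mono hsub₁) hκ hA hA0 hφ (fun z hz => hcell' z (hrows z hz)) hreg
        (Hdfar ℓ₂ (Or.inl rfl))
    · exact good_swapBand L e ℓ₁ ℓ₂ s₁ M₁ p u v (restr B κ) A (hbd'.subset hsub₁) hdom₁
        (by rw [hi₁]; exact hint'.mono hsub₁) hu hv hne hsame huℓ (hregion M₁ κ s₁ hκ hdom₁ hstrict)
        (Hpar 0 (Or.inr rfl)) (Hdthick 0 (Or.inr rfl)) (Hdfar 0 (Or.inr rfl))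

end Double

end RebasePos

/-- **Registered part of `stub_rebaseSimplePosOne` / `rebaseSimplePos_oneFibre` (line
`janus-bands`, v6.2): the one-fibre rebase from parallel bands and DOUBLE-corner bands.** For
literal one-fibre data over a base of dimension `B + 1` (any bounds, any letter, exponents
`n₁ = 0`, `n₂ = 1`): IF, for the base poles `ℓ₂` and `0`, parallel transverse bands (`Hpar`) and
the DOUBLE-CORNER bands — bands above their apex level `κ` (`u − κ = A (v − u)`, `A > 0`, `κ`
free of `y`), apex level below the letter (`Hdthick`) or far regime `v ≥ 2κ > 0` (`Hdfar`),
whose open base cell has in its closure a corner point `κ = u = v = 0` LYING ON THE POLE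
HYPERPLANE `y = ℓ(x')` — are congruent to the subgroup generated by `GG B 2 1`, THEN so is
`[s]` (`RebasePos.good_oneFibre` + `RebasePos.good_above_of_double`: walls `κ = ±Φ`,
compactness, and the coordinate swap `y ↔ t`; rules 1a, 2). -/
theorem rebaseSimplePos_oneFibre_of_double (B m m' : ℕ) (s : KZ.IntegralRep (B + 1 + 1)) (M : Fin m' → (Fin (B + 1) → ℚ) × ℚ) (L : Fin m → (Fin B → ℚ) × ℚ) (e : Fin m → ℕ) (p : MvPolynomial (Fin B) ℚ) (ℓ₁ ℓ₂ : (Fin B → ℚ) × ℚ) (a : Fin 1 → Option ((Fin (B + 1) → ℚ) × ℚ)) (lo hi : Fin 1 → Fin 1 ⊕ ((Fin (B + 1) → ℚ) × ℚ)) (hbd : Bornology.IsBounded s.domain) (hdom : s.domain = SeparatePos.gDom B 1 m' M lo hi) (hint : EqOn s.integrand (RebasePos.glit B 1 p L e ℓ₁ ℓ₂ 0 1 a) s.domain) (Hpar : ∀ (ℓ : (Fin B → ℚ) × ℚ), (ℓ = ℓ₂ ∨ ℓ = 0) → ∀ (m' : ℕ) (s : KZ.IntegralRep (B + 1 + 1))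 (M : Fin m' → (Fin (B + 1) → ℚ) × ℚ) (p : MvPolynomial (Fin B) ℚ) (u v : (Fin (B + 1) → ℚ) × ℚ), Bornology.IsBounded s.domain → s.domain = SeparatePos.gDom B 1 m' M (fun _ => Sum.inr u) (fun _ => Sum.inr v) → EqOn s.integrand (RebasePos.glit B 1 p L e ℓ₁ ℓ 0 1 (fun _ => some 0)) s.domain → u.1 (Fin.last B) ≠ 0 → u.1 (Fin.last B) = v.1 (Fin.last B) → (∀ z : Fin (B + 1 + 1) → ℝ, (∀ j, 0 < SeparatePos.affF B 1 (M j) z) → 0 < SeparatePos.affF B 1 u z ∧ SeparatePos.affF B 1 u z < SeparatePos.affF B 1 v z) → ∃ c ∈ AddSubgroup.closure (SeparatePos.GGset B 2 1), KZ.of s - c ∈ KZ.relations) (Hdthick : ∀ (ℓ : (Fin B → ℚ) × ℚ), (ℓ = ℓ₂ ∨ ℓ = 0) → ∀ (m' : ℕ) (s : KZ.IntegralRep (B + 1 + 1)) (M : Fin m' → (Fin (B + 1) → ℚ) × ℚ) (p : MvPolynomial (Fin B) ℚ) (u v κ : (Fin (B + 1) → ℚ) × ℚ) (A : ℚ), Bornology.IsBounded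 s.domain → s.domain = SeparatePos.gDom B 1 m' M (fun _ => Sum.inr u) (fun _ => Sum.inr v) → EqOn s.integrand (RebasePos.glit B 1 p L e ℓ₁ ℓ 0 1 (fun _ => some 0)) s.domain → κ.1 (Fin.last B) = 0 → u - κ = A • (v - u) → 0 < A → (∀ z : Fin (B + 1 + 1) → ℝ, (∀ j, 0 < SeparatePos.affF B 1 (M j) z) → SeparatePos.affF B 1 κ z < 0 ∧ 0 < SeparatePos.affF B 1 u z ∧ SeparatePos.affF B 1 u z < SeparatePos.affF B 1 v z) → (∃ z ∈ closure {z : Fin (B + 1 + 1) → ℝ | ∀ j, 0 < SeparatePos.affF B 1 (M j) z}, SeparatePos.affF B 1 κ z = 0 ∧ SeparatePos.affF B 1 u z = 0 ∧ SeparatePos.affF B 1 v z = 0 ∧ z (Fin.castAdd 1 (Fin.last B)) = SeparatePos.affB B 1 ℓ z) → ∃ c ∈ AddSubgroup.closure (SeparatePos.GGset B 2 1), KZ.of s - c ∈ KZ.relations) (Hdfar : ∀ (ℓ : (Fin B → ℚ) × ℚ), (ℓ = ℓ₂ ∨ ℓ = 0) → ∀ (m' : ℕ) (s : KZ.IntegralRep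 (B + 1 + 1)) (M : Fin m' → (Fin (B + 1) → ℚ) × ℚ) (p : MvPolynomial (Fin B) ℚ) (u v κ : (Fin (B + 1) → ℚ) × ℚ) (A : ℚ), Bornology.IsBounded s.domain → s.domain = SeparatePos.gDom B 1 m' M (fun _ => Sum.inr u) (fun _ => Sum.inr v) → EqOn s.integrand (RebasePos.glit B 1 p L e ℓ₁ ℓ 0 1 (fun _ => some 0)) s.domain → κ.1 (Fin.last B) = 0 → u - κ = A • (v - u) → 0 < A → (∀ z : Fin (B + 1 + 1) → ℝ, (∀ j, 0 < SeparatePos.affF B 1 (M j) z) → 0 < SeparatePos.affF B 1 κ z ∧ SeparatePos.affF B 1 u z < SeparatePos.affF B 1 v z ∧ 2 * SeparatePos.affF B 1 κ z ≤ SeparatePos.affF B 1 v z) → (∃ z ∈ closure {z : Fin (B + 1 + 1) → ℝ | ∀ j, 0 < SeparatePos.affF B 1 (M j) z}, SeparatePos.affF B 1 κ z = 0 ∧ SeparatePos.affF B 1 u z = 0 ∧ SeparatePos.affF B 1 v z = 0 ∧ z (Fin.castAdd 1 (Fin.last B)) = SeparatePos.affB B 1 ℓ z) → ∃ c ∈ AddSubgroup.closure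 (SeparatePos.GGset B 2 1), KZ.of s - c ∈ KZ.relations) : ∃ c ∈ AddSubgroup.closure (SeparatePos.GGset B 2 1), KZ.of s - c ∈ KZ.relations :=
  RebasePos.good_oneFibre L e ℓ₁ ℓ₂ 0 1 s M p a lo hi (Or.inl rfl) hbd hdom hint
    fun _ s M p u v hbd hdom hint hu hv hcell =>
      RebasePos.good_above_of_double L e ℓ₁ ℓ₂ s M p u v hbd hdom hint hu hv hcell Hpar Hdthick Hdfar

/-- **The stub `stub_rebaseSimplePosOne` with the narrow target `GG (b+1) 2 1`, reduced to
parallel bands and DOUBLE-corner bands** (exactly its signature plus `Hpar`, `Hdthick`,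
`Hdfar`, quantified over all parameters `m L e ℓ₁ ℓ₂`): `GS (b+1) 1 → closure (GG (b+1) 2 1)`
modulo `KZ.relations`. The double-corner bands (apex of the band on the letter AND on the pole
hyperplane `y = ℓ₂(x')` at a boundary point of the base cell) are what is left of the
one-fibre rebase besides the parallel bands. -/
theorem rebaseSimplePos_oneFibre_of_double' (GS : ℕ → ℕ → Set KZ.FormalRep) (GG : ℕ → ℕ → ℕ → Set KZ.FormalRep) (hGS : ∀ b k, GS b k = {w : KZ.FormalRep | ∃ (m m' n₁ n₂ : ℕ) (s : KZ.IntegralRep (b + 1 + k)) (M : Fin m' → (Fin (b + 1) → ℚ) × ℚ) (L : Fin m → (Fin b → ℚ) × ℚ) (e : Fin m → ℕ) (p : MvPolynomial (Fin b) ℚ) (ℓ₁ ℓ₂ : (Fin b → ℚ) × ℚ) (a : Fin k → Option ((Fin (b + 1) → ℚ) × ℚ)) (lo hi : Fin k → Fin k ⊕ ((Fin (b + 1) → ℚ) × ℚ)), (n₁ = 0 ∨ n₂ = 0) ∧ n₂ = 1 ∧ Bornology.IsBounded s.domain ∧ s.domain = {z | (∀ j, 0 < ∑ i, ((M j).1 i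 : ℝ) * z (Fin.castAdd k i) + ((M j).2 : ℝ)) ∧ ∀ i, Sum.elim (fun j => z (Fin.natAdd (b + 1) j)) (fun c => ∑ i', (c.1 i' : ℝ) * z (Fin.castAdd k i') + (c.2 : ℝ)) (lo i) < z (Fin.natAdd (b + 1) i) ∧ z (Fin.natAdd (b + 1) i) < Sum.elim (fun j => z (Fin.natAdd (b + 1) j)) (fun c => ∑ i', (c.1 i' : ℝ) * z (Fin.castAdd k i') + (c.2 : ℝ)) (hi i)} ∧ EqOn s.integrand (fun z => MvPolynomial.aeval (fun i => z (Fin.castAdd k (Fin.castSucc i))) p / (∏ j, (∑ i, ((L j).1 i : ℝ) * z (Fin.castAdd k (Fin.castSucc i)) + ((L j).2 : ℝ)) ^ e j) * ((z (Fin.castAdd k (Fin.last b)) - (∑ i, (ℓ₁.1 i : ℝ) * z (Fin.castAdd k (Fin.castSucc i)) + (ℓ₁.2 : ℝ))) ^ n₁ / (z (Fin.castAdd k (Fin.last b)) - (∑ i, (ℓ₂.1 i : ℝ) * z (Fin.castAdd k (Fin.castSucc i)) + (ℓ₂.2 : ℝ))) ^ n₂) * ∏ i, (a i).elim 1 (fun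 c => 1 / (z (Fin.natAdd (b + 1) i) - (∑ i', (c.1 i' : ℝ) * z (Fin.castAdd k i') + (c.2 : ℝ))))) s.domain ∧ w = KZ.of s}) (hGG : ∀ b σ k, GG b σ k = {w : KZ.FormalRep | ∃ (m m' n₁ n₂ : ℕ) (s : KZ.IntegralRep (b + 1 + k)) (M : Fin m' → (Fin (b + 1) → ℚ) × ℚ) (L : Fin m → (Fin b → ℚ) × ℚ) (e : Fin m → ℕ) (p : MvPolynomial (Fin b) ℚ) (ℓ₁ ℓ₂ : (Fin b → ℚ) × ℚ) (a : Fin k → Option ((Fin (b + 1) → ℚ) × ℚ)) (lo hi : Fin k → Fin k ⊕ ((Fin (b + 1) → ℚ) × ℚ)), (n₁ = 0 ∨ n₂ = 0) ∧ (σ = 2 → (∀ i c, a i = some c → c.1 (Fin.last b) = 0) ∧ (∀ i c, (lo i = Sum.inr c ∨ hi i = Sum.inr c) → (c.1 (Fin.last b) = 0 ∨ c = (Pi.single (Fin.last b) 1, 0)))) ∧ Bornology.IsBounded s.domain ∧ s.domain = {z | (∀ j, 0 < ∑ i, ((M j).1 i : ℝ) * z (Fin.castAdd k i) + ((M j).2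 : ℝ)) ∧ ∀ i, Sum.elim (fun j => z (Fin.natAdd (b + 1) j)) (fun c => ∑ i', (c.1 i' : ℝ) * z (Fin.castAdd k i') + (c.2 : ℝ)) (lo i) < z (Fin.natAdd (b + 1) i) ∧ z (Fin.natAdd (b + 1) i) < Sum.elim (fun j => z (Fin.natAdd (b + 1) j)) (fun c => ∑ i', (c.1 i' : ℝ) * z (Fin.castAdd k i') + (c.2 : ℝ)) (hi i)} ∧ EqOn s.integrand (fun z => MvPolynomial.aeval (fun i => z (Fin.castAdd k (Fin.castSucc i))) p / (∏ j, (∑ i, ((L j).1 i : ℝ) * z (Fin.castAdd k (Fin.castSucc i)) + ((L j).2 : ℝ)) ^ e j) * ((z (Fin.castAdd k (Fin.last b)) - (∑ i, (ℓ₁.1 i : ℝ) * z (Fin.castAdd k (Fin.castSucc i)) + (ℓ₁.2 : ℝ))) ^ n₁ / (z (Fin.castAdd k (Fin.last b)) - (∑ i, (ℓ₂.1 i : ℝ) * z (Fin.castAdd k (Fin.castSucc i)) + (ℓ₂.2 : ℝ))) ^ n₂) * ∏ i, (a i).elim 1 (fun c => 1 / (z (Fin.natAdd (b + 1) i) - (∑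 i', (c.1 i' : ℝ) * z (Fin.castAdd k i') + (c.2 : ℝ))))) s.domain ∧ w = KZ.of s}) (b : ℕ) (Hpar : ∀ (m : ℕ) (L : Fin m → (Fin (b + 1) → ℚ) × ℚ) (e : Fin m → ℕ) (ℓ₁ ℓ₂ : (Fin (b + 1) → ℚ) × ℚ), ∀ (m' : ℕ) (s : KZ.IntegralRep (b + 1 + 1 + 1)) (M : Fin m' → (Fin (b + 1 + 1) → ℚ) × ℚ) (p : MvPolynomial (Fin (b + 1)) ℚ) (u v : (Fin (b + 1 + 1) → ℚ) × ℚ), Bornology.IsBounded s.domain → s.domain = SeparatePos.gDom (b + 1) 1 m' M (fun _ => Sum.inr u) (fun _ => Sum.inr v) → EqOn s.integrand (RebasePos.glit (b + 1) 1 p L e ℓ₁ ℓ₂ 0 1 (fun _ => some 0)) s.domain → u.1 (Fin.last (b + 1)) ≠ 0 → u.1 (Fin.last (b + 1)) = v.1 (Fin.last (b + 1)) → (∀ z : Fin (b + 1 + 1 + 1) → ℝ, (∀ j, 0 < SeparatePos.affF (b + 1) 1 (M j) z) → 0 < SeparatePos.affF (b + 1) 1 u z ∧ SeparatePos.affF (b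 + 1) 1 u z < SeparatePos.affF (b + 1) 1 v z) → ∃ c ∈ AddSubgroup.closure (SeparatePos.GGset (b + 1) 2 1), KZ.of s - c ∈ KZ.relations) (Hdthick : ∀ (m : ℕ) (L : Fin m → (Fin (b + 1) → ℚ) × ℚ) (e : Fin m → ℕ) (ℓ₁ ℓ₂ : (Fin (b + 1) → ℚ) × ℚ), ∀ (m' : ℕ) (s : KZ.IntegralRep (b + 1 + 1 + 1)) (M : Fin m' → (Fin (b + 1 + 1) → ℚ) × ℚ) (p : MvPolynomial (Fin (b + 1)) ℚ) (u v κ : (Fin (b + 1 + 1) → ℚ) × ℚ) (A : ℚ), Bornology.IsBounded s.domain → s.domain = SeparatePos.gDom (b + 1) 1 m' M (fun _ => Sum.inr u) (fun _ => Sum.inr v) → EqOn s.integrand (RebasePos.glit (b + 1) 1 p L e ℓ₁ ℓ₂ 0 1 (fun _ => some 0)) s.domain → κ.1 (Fin.last (b + 1)) = 0 → u - κ = A • (v - u) → 0 < A → (∀ z : Fin (b + 1 + 1 + 1) → ℝ, (∀ j, 0 < SeparatePos.affF (b + 1) 1 (M j) z) → SeparatePos.affF (b + 1) 1 κ z < 0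 ∧ 0 < SeparatePos.affF (b + 1) 1 u z ∧ SeparatePos.affF (b + 1) 1 u z < SeparatePos.affF (b + 1) 1 v z) → (∃ z ∈ closure {z : Fin (b + 1 + 1 + 1) → ℝ | ∀ j, 0 < SeparatePos.affF (b + 1) 1 (M j) z}, SeparatePos.affF (b + 1) 1 κ z = 0 ∧ SeparatePos.affF (b + 1) 1 u z = 0 ∧ SeparatePos.affF (b + 1) 1 v z = 0 ∧ z (Fin.castAdd 1 (Fin.last (b + 1))) = SeparatePos.affB (b + 1) 1 ℓ₂ z) → ∃ c ∈ AddSubgroup.closure (SeparatePos.GGset (b + 1) 2 1), KZ.of s - c ∈ KZ.relations) (Hdfar : ∀ (m : ℕ) (L : Fin m → (Fin (b + 1) → ℚ) × ℚ) (e : Fin m → ℕ) (ℓ₁ ℓ₂ : (Fin (b + 1) → ℚ) × ℚ), ∀ (m' : ℕ) (s : KZ.IntegralRep (b + 1 + 1 + 1)) (M : Fin m' → (Fin (b + 1 + 1) → ℚ) × ℚ) (p : MvPolynomial (Fin (b + 1)) ℚ) (u v κ : (Fin (b + 1 + 1) → ℚ) × ℚ) (A : ℚ), Bornology.IsBounded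 s.domain → s.domain = SeparatePos.gDom (b + 1) 1 m' M (fun _ => Sum.inr u) (fun _ => Sum.inr v) → EqOn s.integrand (RebasePos.glit (b + 1) 1 p L e ℓ₁ ℓ₂ 0 1 (fun _ => some 0)) s.domain → κ.1 (Fin.last (b + 1)) = 0 → u - κ = A • (v - u) → 0 < A → (∀ z : Fin (b + 1 + 1 + 1) → ℝ, (∀ j, 0 < SeparatePos.affF (b + 1) 1 (M j) z) → 0 < SeparatePos.affF (b + 1) 1 κ z ∧ SeparatePos.affF (b + 1) 1 u z < SeparatePos.affF (b + 1) 1 v z ∧ 2 * SeparatePos.affF (b + 1) 1 κ z ≤ SeparatePos.affF (b + 1) 1 v z) → (∃ z ∈ closure {z : Fin (b + 1 + 1 + 1) → ℝ | ∀ j, 0 < SeparatePos.affF (b + 1) 1 (M j) z}, SeparatePos.affF (b + 1) 1 κ z = 0 ∧ SeparatePos.affF (b + 1) 1 u z = 0 ∧ SeparatePos.affF (b + 1) 1 v z = 0 ∧ z (Fin.castAdd 1 (Fin.last (b + 1))) = SeparatePos.affB (b + 1) 1 ℓ₂ z) → ∃ c ∈ AddSubgroup.closure (SeparatePos.GGset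 (b + 1) 2 1), KZ.of s - c ∈ KZ.relations) : ∀ x ∈ GS (b + 1) 1, ∃ c ∈ AddSubgroup.closure (GG (b + 1) 2 1), x - c ∈ KZ.relations := by
  intro x hx
  rw [hGS] at hx
  obtain ⟨m, m', n₁, n₂, s, M, L, e, p, ℓ₁, ℓ₂, a, lo, hi, h12, hn₂, hbd, hdom, hint, rfl⟩ := hx
  obtain rfl : n₁ = 0 := h12.resolve_right (by rw [hn₂]; exact one_ne_zero)
  subst hn₂
  rw [hGG]
  exact rebaseSimplePos_oneFibre_of_double (b + 1) m m' s M L e p ℓ₁ ℓ₂ a lo hi hbd hdom hint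
    (fun ℓ _ => Hpar m L e ℓ₁ ℓ) (fun ℓ _ => Hdthick m L e ℓ₁ ℓ) (fun ℓ _ => Hdfar m L e ℓ₁ ℓ)

end Summit.KontsevichZagierPeriods.ArrangementNormalForm.JanusBands
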